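import Summits.QuantumFields.YangMills.Theorems.BalabanLadderIRTemperedRecursion
import Summits.QuantumFields.YangMills.Theorems.BalabanLadderIRFrameCells
import Summits.QuantumFields.YangMills.Theorems.OneCertifiedCubeFiniteSizeCriterion
import HarnessLib

/-!
# The engine of line L2″, proved: cell-tempered ⇒ 8895's finite-size hypothesis (engine part 2b/2)

Helper module for item `stmt-QuantumFields-19354` (crux `IR` of route `BalabanLadder`; registered line L2″
«cell-tempered», skeleton of record `IR_birth_cell_v7.lean`).  Route owner ym-beyond-p2 (g17), filed by the cell's
courier.  It DISCHARGES the engine stub `Cruxes.IR.CellTempered.stub_temperedToTV : TemperedToTV` (by `exact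
Engine.temperedToTV_proved`; the statement below is `TemperedToTV` with the skeleton's `CellTemperedCond` /
`TVCondAt` unfolded, text verbatim), after which the line has exactly ONE open stub, the crux certificate
`stub_cellCert : IRCellCertificate`.

Proof.  Constants: `M = M(n) = (4n+3)⁴ − (4n+1)⁴ ≥ 1` (so `ε ≤ εM < 1`), `J ≥ 1` with `(εM)^J (J(8n+7))⁴ ≤ 1/4`
(`exists_pow_mul_le`, from `J⁴ q^J → 0`), `n' = J(2n+1)` (so `M(n') ≤ (4n'+3)⁴ ≤ (J(8n+7))⁴` and the window of
radius `2n'` contains every cell within index distance `J(2n+1)`), `δ₀ = 1/(16·M·J·(M(n')+1))`,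
`ε' = (εM)^J + 4MJδ₀`; then `ε'·M(n') ≤ 1/4 + 1/4 < 1`.  Implication: `G` is Hausdorff and second countable
(closed embedding `ρ`), so the Wilson kernels form a specification (`isSpecification_ymSpecification_of_t2Space`)
with range-one quasilocality (`dependsOn_integral_ymSpecification`); given a mesh-`b` frame `w`, choose the good
events of all shifted frames `shiftFrame w x` from the cell-tempered condition, feed `hBad_of_rare` / `hFS_of_mix`
(`Theorems.BalabanLadderIRFrameCells`) into `Engine.tempered_recursion_decay` at the cell map `frameCell w`, `x = 0`,
`Λ =` the region of `Y`, depth `J`: influence `≤ (εM)^J + 4Mδ·Σ_{i<J}(εM)^i ≤ (εM)^J + 4MJδ₀ = ε'`.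

## References
* R. L. Dobrushin, S. B. Shlosman, *Completely analytical Gibbs fields* (1985); *Constructive criterion for the
  uniqueness of Gibbs field* (1985), §2 (the finite-size criterion being tempered here).
* L. A. Bassalygo, R. L. Dobrushin, Theory Probab. Appl. 31 (1986) (criteria with a «bad set»).
* J. van den Berg, C. Maes, Ann. Probab. 22 (1994) (disagreement percolation).
-/

set_option autoImplicit false

noncomputable section

open MeasureTheory
open Literature.Probability.LatticeModels
open Literature.MathematicalPhysics.QuantumLattice
open Summit.QuantumFields.YangMills.Theorems.FiniteSizeCriterion

/-! ## Part 2/2, §C — constants and the read-off of 8895's finite-size hypothesis -/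

namespace Summit.QuantumFields.YangMills.Cruxes.IR.CellTempered.Engine

open Filter Topology
open Literature.MathematicalPhysics.QuantumFieldTheory
open Summit.QuantumFields.YangMills.Cruxes.IR.Tempered (cellEdges windowCells regionEdges)
open Summit.QuantumFields.YangMills.Cruxes.IR.ShellTempered (windowCellsPlus)

/-- For `0 ≤ q < 1` and `K > 0` there is `J ≥ 1` with `q^J (J K)^4 ≤ 1/4`. -/
theorem exists_pow_mul_le {q : ℝ} (hq0 : 0 ≤ q) (hq1 : q < 1) (K : ℝ) (hK : 0 < K) :
    ∃ J : ℕ, 1 ≤ J ∧ q ^ J * ((J : ℝ) * K) ^ 4 ≤ 1 / 4 := by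
  have ht : Tendsto (fun J : ℕ => (J : ℝ) ^ 4 * q ^ J) atTop (𝓝 0) :=
    tendsto_pow_const_mul_const_pow_of_abs_lt_one 4 (by rwa [abs_of_nonneg hq0])
  have hK4 : (0 : ℝ) < 1 / (4 * K ^ 4) := by positivity
  obtain ⟨J, hJlt, hJ1⟩ := ((ht.eventually (gt_mem_nhds hK4)).and (eventually_ge_atTop 1)).exists
  refine ⟨J, hJ1, ?_⟩
  have hK4' : (0 : ℝ) < K ^ 4 := by positivity
  calc q ^ J * ((J : ℝ) * K) ^ 4 = ((J : ℝ) ^ 4 * q ^ J) * K ^ 4 := by ring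
    _ ≤ 1 / (4 * K ^ 4) * K ^ 4 := mul_le_mul_of_nonneg_right hJlt.le hK4'.le
    _ = 1 / 4 := by field_simp



/-- **The engine of line L2″ — `stub_temperedToTV`, PROVED.**  For admissible `(n, ε)` (window `n ≥ 1`,
`0 ≤ ε`, `ε·M(n) < 1`, `M(n) = (4n+3)⁴ − (4n+1)⁴`) there are a coarser window `n' = J(2n+1)`, an
admissible `ε' = (εM)^J + 4·M·δ₀·J` and a rarity budget `δ₀ = 1/(16·M·J·(M(n')+1)) > 0` (`J ≥ 1` with
`(εM)^J·(J(8n+7))⁴ ≤ 1/4`) such that, for every compact `G`, every continuous injective matrix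
representation, every `β`, every cell side `b ≥ 1` and every `δ ≤ δ₀`, the CELL-TEMPERED finite-size
condition at `(b, n, ε, δ)` implies the finite-size hypothesis of
`Theses.OneCertifiedCube.FiniteSizeCriterion` at `(b, n', ε')` — both spelled out (the skeleton's
`CellTemperedCond` / `TVCondAt`, text verbatim), so that the registered stub is discharged by `exact`. -/
theorem temperedToTV_proved :
    ∀ (n : ℕ) (ε : ℝ), 1 ≤ n → 0 ≤ ε → ε * ((((4 * n + 3) ^ 4 - (4 * n + 1) ^ 4 : ℕ)) : ℝ) < 1 →
    ∃ (n' : ℕ) (ε' δ₀ : ℝ), 1 ≤ n' ∧ 0 ≤ ε' ∧ ε' * ((((4 * n' + 3) ^ 4 - (4 * n' + 1) ^ 4 : ℕ)) : ℝ) < 1 ∧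
      0 < δ₀ ∧
      ∀ (G : Type) [Group G] [TopologicalSpace G] [IsTopologicalGroup G] [CompactSpace G]
        [MeasurableSpace G] [BorelSpace G] (N : ℕ) (ρ : G →* Matrix (Fin N) (Fin N) ℂ), Continuous ρ →
        Function.Injective ρ → ∀ (β : ℝ) (b : ℕ), 1 ≤ b → ∀ δ : ℝ, 0 ≤ δ → δ ≤ δ₀ →
          ( -- the cell-tempered finite-size condition at `(ρ, β, b, n, ε, δ)` (skeleton `CellTemperedCond`, unfolded)
            ∀ w : Fin 4 → ℤ → ℤ, (∀ i j, w i j + ((b : ℕ) : ℤ) ≤ w i (j + 1) ∧ w i (j + 1) ≤ w i j + 2 * ((b : ℕ) : ℤ)) →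
              ∃ Good : (Fin 4 → ℤ) → Set (LGConfig 4 G),
                (∀ c, MeasurableSet (Good c)) ∧ (∀ c, DependsOn (fun σ : LGConfig 4 G => σ ∈ Good c) ↑(cellEdges w c)) ∧
                (∀ Y : Finset (Fin 4 → ℤ), Y ⊆ windowCells n → (0 : Fin 4 → ℤ) ∈ Y →
                  ∀ σ σ' : LGConfig 4 G,
                    (∀ c ∈ windowCellsPlus n, c ∉ Y → ((∀ e ∈ cellEdges w c, σ e = σ' e) ∨ (σ ∈ Good c ∧ σ' ∈ Good c))) →
                    ∀ f : LGConfig 4 G → ℝ, IsCylinder f (cellEdges w 0) → Measurable f → (∀ U, 0 ≤ f U ∧ f U ≤ 1) →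
                      |(∫ U, f U ∂(ymSpecification ρ β (regionEdges w Y) σ)) -
                        ∫ U, f U ∂(ymSpecification ρ β (regionEdges w Y) σ')| ≤ ε) ∧
                (∀ c : Fin 4 → ℤ, ∀ E' : Finset (Literature.MathematicalPhysics.QuantumLattice.ZdEdge 4), cellEdges w c ⊆ E' →
                  ∀ ζ : LGConfig 4 G, (ymSpecification ρ β E' ζ) (Good c)ᶜ ≤ ENNReal.ofReal δ)) →
          ( -- 8895's finite-size hypothesis at `(ρ, β, b, n', ε')` (skeleton `TVCondAt`, unfolded)
            ∀ w : Fin 4 → ℤ → ℤ, (∀ i j, w i j + ((b : ℕ) : ℤ) ≤ w i (j + 1) ∧ w i (j + 1) ≤ w i j + 2 * ((b : ℕ) : ℤ)) →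
              ∀ Y : Finset (Fin 4 → ℤ), Y ⊆ (Fintype.piFinset fun _ : Fin 4 => Finset.Icc (-(2 * ((n' : ℕ) : ℤ))) (2 * ((n' : ℕ) : ℤ))) →
                (0 : Fin 4 → ℤ) ∈ Y → ∀ η η' : Literature.MathematicalPhysics.QuantumLattice.LGConfig 4 G,
                  (∀ e ∈ (Fintype.piFinset fun _ : Fin 4 => Finset.Icc (-(2 * ((n' : ℕ) : ℤ))) (2 * ((n' : ℕ) : ℤ))).biUnion
                      (fun y : Fin 4 → ℤ => (Fintype.piFinset fun i : Fin 4 => Finset.Ico (w i (y i)) (w i (y i + 1))) ×ˢ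
                        (Finset.univ : Finset (Fin 4))), η e = η' e) →
                  ∀ f : Literature.MathematicalPhysics.QuantumLattice.LGConfig 4 G → ℝ,
                    Literature.MathematicalPhysics.QuantumLattice.IsCylinder f
                      ((fun y : Fin 4 → ℤ => (Fintype.piFinset fun i : Fin 4 => Finset.Ico (w i (y i)) (w i (y i + 1))) ×ˢ
                        (Finset.univ : Finset (Fin 4))) 0) → Measurable f → (∀ U, 0 ≤ f U ∧ f U ≤ 1) →
                    |(∫ U, f U ∂(Literature.MathematicalPhysics.QuantumLattice.ymSpecification ρ β
                        (Y.biUnion (fun y : Fin 4 → ℤ => (Fintype.piFinset fun i : Fin 4 => Finset.Ico (w i (y i)) (w i (y i + 1))) ×ˢ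
                          (Finset.univ : Finset (Fin 4)))) η)) -
                      ∫ U, f U ∂(Literature.MathematicalPhysics.QuantumLattice.ymSpecification ρ β
                        (Y.biUnion (fun y : Fin 4 → ℤ => (Fintype.piFinset fun i : Fin 4 => Finset.Ico (w i (y i)) (w i (y i + 1))) ×ˢ
                          (Finset.univ : Finset (Fin 4)))) η')| ≤ ε') := by
  intro n ε hn hε hq
  -- the constants
  set M : ℝ := ((((4 * n + 3) ^ 4 - (4 * n + 1) ^ 4 : ℕ)) : ℝ) with hMdef
  have hM1 : (1 : ℝ) ≤ M := by
    have hlt : (4 * n + 1) ^ 4 < (4 * n + 3) ^ 4 := Nat.pow_lt_pow_left (by omega) (by norm_num)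
    rw [hMdef]
    exact_mod_cast Nat.one_le_iff_ne_zero.2 (Nat.sub_ne_zero_of_lt hlt)
  have hM0 : 0 < M := by linarith
  set q : ℝ := ε * M with hqdef
  have hq0 : 0 ≤ q := by positivity
  have hε1 : ε ≤ 1 := by nlinarith
  obtain ⟨J, hJ1, hJ⟩ := exists_pow_mul_le hq0 hq (8 * n + 7) (by positivity)
  have hJ0 : (0 : ℝ) < J := by exact_mod_cast hJ1
  set n' : ℕ := J * (2 * n + 1) with hn'def
  set M' : ℝ := ((((4 * n' + 3) ^ 4 - (4 * n' + 1) ^ 4 : ℕ)) : ℝ) with hM'def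
  have hM'0 : 0 ≤ M' := by positivity
  have hM'le : M' ≤ ((J : ℝ) * (8 * n + 7)) ^ 4 := by
    have h1 : (((4 * n' + 3) ^ 4 - (4 * n' + 1) ^ 4 : ℕ) : ℝ) ≤ (((4 * n' + 3) ^ 4 : ℕ) : ℝ) := by
      exact_mod_cast Nat.sub_le _ _
    have h2 : (((4 * n' + 3) ^ 4 : ℕ) : ℝ) = (4 * (n' : ℝ) + 3) ^ 4 := by push_cast; ring
    have hJ1' : (1 : ℝ) ≤ J := by exact_mod_cast hJ1
    have h3 : 4 * (n' : ℝ) + 3 ≤ (J : ℝ) * (8 * n + 7) := by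
      rw [hn'def]; push_cast; nlinarith [hJ1']
    calc M' ≤ (4 * (n' : ℝ) + 3) ^ 4 := by rw [hM'def, ← h2]; exact h1
      _ ≤ ((J : ℝ) * (8 * n + 7)) ^ 4 := pow_le_pow_left₀ (by positivity) h3 4
  set δ₀ : ℝ := 1 / (16 * M * J * (M' + 1)) with hδ₀def
  have hδ₀ : 0 < δ₀ := by positivity
  set ε' : ℝ := q ^ J + 4 * M * δ₀ * J with hε'def
  have hε'0 : 0 ≤ ε' := by positivity
  refine ⟨n', ε', δ₀, Nat.succ_le_of_lt (Nat.mul_pos (by omega) (by omega)), hε'0, ?_, hδ₀, ?_⟩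
  · have h1 : q ^ J * M' ≤ 1 / 4 := (mul_le_mul_of_nonneg_left hM'le (pow_nonneg hq0 J)).trans hJ
    have h2 : 4 * M * δ₀ * J * M' ≤ 1 / 4 := by
      have h3 : 4 * M * δ₀ * J * M' = (M' / (M' + 1)) / 4 := by
        rw [hδ₀def]; field_simp; ring
      have h4 : M' / (M' + 1) ≤ 1 := by rw [div_le_one (by positivity)]; linarith
      rw [h3]; linarith
    calc ε' * M' = q ^ J * M' + 4 * M * δ₀ * J * M' := by rw [hε'def]; ring
      _ ≤ 1 / 4 + 1 / 4 := add_le_add h1 h2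
      _ < 1 := by norm_num
  -- the implication
  intro G _ _ _ _ _ _ N ρ hρc hρi β b hb δ hδ hδδ₀ hCT
  haveI : T2Space G := (hρc.isClosedEmbedding hρi).isEmbedding.t2Space
  haveI : SecondCountableTopology G :=
    (hρc.isClosedEmbedding hρi).isEmbedding.secondCountableTopology
  have hγ := isSpecification_ymSpecification_of_t2Space (d := 4) ρ hρc β
  intro w hwb Y' _hY' _h0 η η' hagree f hf hfm hf01
  have hw1 : ∀ i j, w i j + 1 ≤ w i (j + 1) := fun i j => by
    have h := (hwb i j).1
    have hb1 : (1 : ℤ) ≤ ((b : ℕ) : ℤ) := by exact_mod_cast hb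
    linarith
  -- the good events of all shifted frames
  have hex := fun x : Fin 4 → ℤ => hCT (shiftFrame w x) (shiftFrame_mesh hwb x)
  choose GoodW hGmW _hGdepW hmixW hrareW using hex
  -- `f` depends on the central cell
  have hdep : DependsOn f {v | frameCell w v = 0} := by
    intro σ σ' h
    refine hf fun e he => h e ?_
    exact (frameCell_eq_iff hw1 e 0).2 (Finset.mem_coe.1 he)
  -- agreement on the window of radius `2n'` ⇒ agreement within cell radius `J(2n+1)` off the region
  have hagree' : ∀ v, v ∉ regionEdges w Y' →
      (∀ i, |frameCell w v i - (0 : Fin 4 → ℤ) i| ≤ (J : ℤ) * (2 * (n : ℤ) + 1)) → η v = η' v := by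
    intro v _ hv
    refine hagree v (Finset.mem_biUnion.2 ⟨frameCell w v, ?_, mem_cellEdges_frameCell hw1 v⟩)
    rw [Fintype.mem_piFinset]
    intro i
    have h := abs_le.1 (hv i)
    simp only [Pi.zero_apply, sub_zero] at h
    have hn' : ((n' : ℕ) : ℤ) = (J : ℤ) * (2 * (n : ℤ) + 1) := by rw [hn'def]; push_cast; ring
    rw [Finset.mem_Icc, hn']
    constructor <;> nlinarith [h.1, h.2]
  -- the tempered decay bound
  have hdec := tempered_recursion_decay (d := 4) hγ
    (fun Λ g T hg hT => dependsOn_integral_ymSpecification ρ hρc β Λ hg hT)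
    (cell := frameCell w) (frame_hC1 hw1) (finite_frameCell hw1) hε hε1
    (fun x c => GoodW x (c - x)) (fun x c => hGmW x (c - x)) hδ
    (fun x c E hE ζ => hBad_of_rare (ymSpecification ρ β) hw1 GoodW hrareW x c E hE ζ)
    (fun x Λ₀ hunion hnear hx σ σ' hT g hgdep hgm hg01 =>
      hFS_of_mix (ymSpecification ρ β) hw1 GoodW hmixW x Λ₀ hunion hnear hx σ σ' hT g hgdep hgm hg01)
    J (regionEdges w Y') (regionEdges_union hw1 Y') 0 f hfm hf01 hdep η η' hagree'
  rw [show 2 * (2 * n + 1) + 1 = 4 * n + 3 by ring, show 2 * (2 * n) + 1 = 4 * n + 1 by ring] at hdec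
  -- the geometric sum is at most `J`, and `δ ≤ δ₀`
  have hsum : ∑ i ∈ Finset.range J, (ε * M) ^ i ≤ J := by
    have h : ∑ i ∈ Finset.range J, (ε * M) ^ i ≤ ∑ _i ∈ Finset.range J, (1 : ℝ) :=
      Finset.sum_le_sum fun i _ => pow_le_one₀ hq0 hq.le
    simpa using h
  have hbound : (ε * M) ^ J + 4 * M * δ * ∑ i ∈ Finset.range J, (ε * M) ^ i ≤ ε' := by
    rw [hε'def, hqdef]
    have h1 : 4 * M * δ * ∑ i ∈ Finset.range J, (ε * M) ^ i ≤ 4 * M * δ * J :=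
      mul_le_mul_of_nonneg_left hsum (by positivity)
    have h2 : 4 * M * δ * (J : ℝ) ≤ 4 * M * δ₀ * J := by
      have := mul_le_mul_of_nonneg_left hδδ₀ (by positivity : (0 : ℝ) ≤ 4 * M * J)
      nlinarith
    linarith
  change |∫ U, f U ∂(ymSpecification ρ β (regionEdges w Y') η) -
      ∫ U, f U ∂(ymSpecification ρ β (regionEdges w Y') η')| ≤ ε'
  exact hdec.trans hbound

end Summit.QuantumFields.YangMills.Cruxes.IR.CellTempered.Engine

end
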